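import Summits.KontsevichZagierPeriods.KontsevichZagierPeriods.Theorems.LinRedNormalFormArrangementNormalFormSeparateThreeHHKForms
import Summits.KontsevichZagierPeriods.KontsevichZagierPeriods.Theorems.LinRedNormalFormArrangementNormalFormSeparateThreeHIPoly

/-!
# The numerator along a nested sector at a direction of the pole plane: adapted graded forms

(Line `janus-bands`, crux `ArrangementNormalForm`, stub `stub_separateHigh`, part `HHKFormsB` of
the wall-invariant termwise-split lemma `separateThree_hHk` in base dimension `3` with fibres.)
At a base point `z₁` of the pole plane and a direction `d` IN the pole plane, the coefficient
polynomials are re-expanded in a basis `(d′, c′)` of the `x′`-plane (ADAPTED real Taylor data `β`,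
`exists_data_adapted`); along the nested sector with frame `Q = Qy E + Qc c`, `S = Sy E + Sc c`
the Taylor pieces become `G3p i = ∑ β i r j t^{i+r+j} v^{i+j} L₁(u)^i L₂(u)^j`
(`L₁ = Qy + u Sy`, `L₂ = Qc + u Sc`). Bookkeeping for the ray theorems of part `HHKRay`:
SLOPE frames — rows `Gam i a b = gam i a b · L₁^i L₂^{b−i}` (`Gam_eq`), the row `Hrow a b` of the
numerator as a polynomial in `u` (`Rrow`), BIGRADING EXACTNESS (`Gam_zero_of_Hrow_zero`, via
`SepHHK.indep_binary`; registered as `separateThreeHHK_formsB`); MONOMIAL frames — tensors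
`gmon i` with `pev₃ (gmon i) = G3p i` and pairwise disjoint supports (`gmon_disjoint`).
-/

noncomputable section

open Set MvPolynomial Polynomial

namespace Summit.KontsevichZagierPeriods.ArrangementNormalForm.JanusBands

namespace SepHHK

open SepTwo

variable {D : ℕ}

/-! ### Adapted real Taylor data -/

/-- **Real Taylor data adapted to a basis of the `x′`-plane.** -/
theorem exists_data_adapted (N : ℕ) (q : ℕ → MvPolynomial (Fin 2) ℝ) (z₁' dw cw : Fin 2 → ℝ) :
    ∃ (D : ℕ) (hND : N ≤ D + 1) (β : Coef₃ D),
      (∀ (i : ℕ) (hi : i < N) (w₁ w₂ : ℝ),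
        MvPolynomial.eval (z₁' + w₁ • dw + w₂ • cw) (q i) = pev₂ (β ⟨i, lt_of_lt_of_le hi hND⟩) w₁ w₂) ∧
      (∀ i : Fin (D + 1), N ≤ (i : ℕ) → β i = 0) := by
  set g : Fin 2 → MvPolynomial (Fin 2) ℝ :=
    fun k => MvPolynomial.C (z₁' k) + MvPolynomial.C (dw k) * MvPolynomial.X 0 +
      MvPolynomial.C (cw k) * MvPolynomial.X 1 with hg
  set qh : ℕ → MvPolynomial (Fin 2) ℝ := fun i => bind₁ g (q i) with hqh
  obtain ⟨D, hND, β, hβ, hβ0⟩ := SepThree.exists_coef_data N qh 0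
  refine ⟨D, hND, β, fun i hi w₁ w₂ => ?_, hβ0⟩
  have h := hβ i hi ![w₁, w₂]
  rw [zero_add] at h
  have hev : MvPolynomial.eval ![w₁, w₂] (qh i) = MvPolynomial.eval (z₁' + w₁ • dw + w₂ • cw) (q i) := by
    simp only [hqh]
    rw [← MvPolynomial.coe_aeval_eq_eval, ← MvPolynomial.coe_aeval_eq_eval]
    show (MvPolynomial.aeval ![w₁, w₂]) (bind₁ g (q i)) =
      (MvPolynomial.aeval (z₁' + w₁ • dw + w₂ • cw)) (q i)
    have hf : (fun k => (MvPolynomial.aeval ![w₁, w₂]) (g k)) = z₁' + w₁ • dw + w₂ • cw := by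
      funext k
      simp only [hg, map_add, map_mul, MvPolynomial.aeval_C, MvPolynomial.aeval_X,
        Algebra.algebraMap_self, RingHom.id_apply, Matrix.cons_val_zero, Matrix.cons_val_one, Pi.add_apply,
        Pi.smul_apply, smul_eq_mul]
      ring
    rw [aeval_bind₁, hf]
  rw [← hev, h]
  rfl

/-! ### The pieces along the sector and their rows -/

/-- The `t`-degree index of the monomial `(i, r, j)`. -/
def finA (i r j : Fin (D + 1)) : Fin (3 * D + 1) := ⟨(i : ℕ) + r + j, by omega⟩

/-- The `v`-degree index of the monomial `(i, r, j)`. -/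
def finB (i j : Fin (D + 1)) : Fin (3 * D + 1) := ⟨(i : ℕ) + j, by omega⟩

/-- A single exponent as an index. -/
def finC (j : Fin (D + 1)) : Fin (3 * D + 1) := ⟨(j : ℕ), by omega⟩

/-- The Taylor piece `i` along the sector. -/
def G3p (β : Coef₃ D) (Qy Sy Qc Sc : ℝ) (i : Fin (D + 1)) (t v u : ℝ) : ℝ :=
  ∑ r : Fin (D + 1), ∑ j : Fin (D + 1), β i r j * t ^ ((i : ℕ) + r + j) * v ^ ((i : ℕ) + j) *
    (Qy + u * Sy) ^ (i : ℕ) * (Qc + u * Sc) ^ (j : ℕ)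

/-- The row `(a, b)` of the piece `i`, as a function of `u`. -/
def Gam (β : Coef₃ D) (Qy Sy Qc Sc : ℝ) (i : Fin (D + 1)) (a b : Fin (3 * D + 1)) (u : ℝ) : ℝ :=
  ∑ r : Fin (D + 1), ∑ j : Fin (D + 1), if a = finA i r j ∧ b = finB i j then
    β i r j * (Qy + u * Sy) ^ (i : ℕ) * (Qc + u * Sc) ^ (j : ℕ) else 0

/-- The coefficient of the row `(a, b)` of the piece `i`. -/
def gam (β : Coef₃ D) (i : Fin (D + 1)) (a b : Fin (3 * D + 1)) : ℝ :=
  ∑ r : Fin (D + 1), ∑ j : Fin (D + 1), if a = finA i r j ∧ b = finB i j then β i r j else 0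

/-- The row `(a, b)` of the numerator. -/
def Hrow (β : Coef₃ D) (Qy Sy Qc Sc : ℝ) (a b : Fin (3 * D + 1)) (u : ℝ) : ℝ :=
  ∑ i : Fin (D + 1), Gam β Qy Sy Qc Sc i a b u

/-- **Double Kronecker sums in two variables.** -/
theorem sum₂_kron (ℓ : Fin (D + 1) → Fin (D + 1) → ℝ)
    (A B : Fin (D + 1) → Fin (D + 1) → Fin (3 * D + 1)) (t v : ℝ) :
    (∑ a : Fin (3 * D + 1), ∑ b : Fin (3 * D + 1),
      (∑ r : Fin (D + 1), ∑ j : Fin (D + 1), if a = A r j ∧ b = B r j then ℓ r j else 0) *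
        t ^ (a : ℕ) * v ^ (b : ℕ)) =
      ∑ r : Fin (D + 1), ∑ j : Fin (D + 1), ℓ r j * t ^ (A r j : ℕ) * v ^ (B r j : ℕ) := by
  classical
  set X : Fin (3 * D + 1) → Fin (3 * D + 1) → Fin (D + 1) → Fin (D + 1) → ℝ :=
    fun a b r j => (if a = A r j ∧ b = B r j then ℓ r j else 0) * t ^ (a : ℕ) * v ^ (b : ℕ) with hX
  have hk : ∀ r j, (∑ a : Fin (3 * D + 1), ∑ b : Fin (3 * D + 1), X a b r j) =
      ℓ r j * t ^ (A r j : ℕ) * v ^ (B r j : ℕ) := by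
    intro r j
    have h : ∀ a b, X a b r j = if a = A r j then (if b = B r j then
        ℓ r j * t ^ (a : ℕ) * v ^ (b : ℕ) else 0) else 0 := by
      intro a b
      show (if a = A r j ∧ b = B r j then ℓ r j else 0) * t ^ (a : ℕ) * v ^ (b : ℕ) = _
      split_ifs with h1 h2 h3 <;> simp_all
    rw [Finset.sum_eq_single (A r j)]
    · rw [Finset.sum_eq_single (B r j)]
      · rw [h, if_pos rfl, if_pos rfl]
      · intro b _ hb; rw [h, if_pos rfl, if_neg hb]
      · intro hn; exact absurd (Finset.mem_univ _) hn
    · intro a _ ha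
      exact Finset.sum_eq_zero fun b _ => by rw [h, if_neg ha]
    · intro hn; exact absurd (Finset.mem_univ _) hn
  calc (∑ a : Fin (3 * D + 1), ∑ b : Fin (3 * D + 1),
        (∑ r : Fin (D + 1), ∑ j : Fin (D + 1), if a = A r j ∧ b = B r j then ℓ r j else 0) *
          t ^ (a : ℕ) * v ^ (b : ℕ))
      = ∑ a : Fin (3 * D + 1), ∑ b : Fin (3 * D + 1), ∑ r : Fin (D + 1), ∑ j : Fin (D + 1),
          X a b r j := by
        simp only [Finset.sum_mul]
        rfl
    _ = ∑ a : Fin (3 * D + 1), ∑ r : Fin (D + 1), ∑ b : Fin (3 * D + 1), ∑ j : Fin (D + 1),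
          X a b r j := Finset.sum_congr rfl fun a _ => Finset.sum_comm
    _ = ∑ r : Fin (D + 1), ∑ a : Fin (3 * D + 1), ∑ b : Fin (3 * D + 1), ∑ j : Fin (D + 1),
          X a b r j := Finset.sum_comm
    _ = ∑ r : Fin (D + 1), ∑ a : Fin (3 * D + 1), ∑ j : Fin (D + 1), ∑ b : Fin (3 * D + 1),
          X a b r j := Finset.sum_congr rfl fun r _ => Finset.sum_congr rfl fun a _ => Finset.sum_comm
    _ = ∑ r : Fin (D + 1), ∑ j : Fin (D + 1), ∑ a : Fin (3 * D + 1), ∑ b : Fin (3 * D + 1),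
          X a b r j := Finset.sum_congr rfl fun r _ => Finset.sum_comm
    _ = _ := Finset.sum_congr rfl fun r _ => Finset.sum_congr rfl fun j _ => hk r j

/-- **Double Kronecker sums in three variables.** -/
theorem pev₃_kron (ℓ : Fin (D + 1) → Fin (D + 1) → ℝ)
    (A B C : Fin (D + 1) → Fin (D + 1) → Fin (3 * D + 1)) (t v u : ℝ) :
    pev₃ (fun a b c => ∑ r : Fin (D + 1), ∑ j : Fin (D + 1),
      if a = A r j ∧ b = B r j ∧ c = C r j then ℓ r j else 0) t v u =
      ∑ r : Fin (D + 1), ∑ j : Fin (D + 1),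
        ℓ r j * t ^ (A r j : ℕ) * v ^ (B r j : ℕ) * u ^ (C r j : ℕ) := by
  classical
  unfold pev₃
  set X : Fin (3 * D + 1) → Fin (3 * D + 1) → Fin (3 * D + 1) → Fin (D + 1) → Fin (D + 1) → ℝ :=
    fun a b c r j => (if a = A r j ∧ b = B r j ∧ c = C r j then ℓ r j else 0) *
      t ^ (a : ℕ) * v ^ (b : ℕ) * u ^ (c : ℕ) with hX
  have hk : ∀ r j, (∑ a : Fin (3 * D + 1), ∑ b : Fin (3 * D + 1), ∑ c : Fin (3 * D + 1), X a b c r j) =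
      ℓ r j * t ^ (A r j : ℕ) * v ^ (B r j : ℕ) * u ^ (C r j : ℕ) := by
    intro r j
    have h : ∀ a b c, X a b c r j = if a = A r j then (if b = B r j then (if c = C r j then
        ℓ r j * t ^ (a : ℕ) * v ^ (b : ℕ) * u ^ (c : ℕ) else 0) else 0) else 0 := by
      intro a b c
      show (if a = A r j ∧ b = B r j ∧ c = C r j then ℓ r j else 0) *
        t ^ (a : ℕ) * v ^ (b : ℕ) * u ^ (c : ℕ) = _
      split_ifs with h1 h2 h3 h4 <;> simp_all
    rw [Finset.sum_eq_single (A r j)]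
    · rw [Finset.sum_eq_single (B r j)]
      · rw [Finset.sum_eq_single (C r j)]
        · rw [h, if_pos rfl, if_pos rfl, if_pos rfl]
        · intro c _ hc; rw [h, if_pos rfl, if_pos rfl, if_neg hc]
        · intro hn; exact absurd (Finset.mem_univ _) hn
      · intro b _ hb
        exact Finset.sum_eq_zero fun c _ => by rw [h, if_pos rfl, if_neg hb]
      · intro hn; exact absurd (Finset.mem_univ _) hn
    · intro a _ ha
      exact Finset.sum_eq_zero fun b _ => Finset.sum_eq_zero fun c _ => by rw [h, if_neg ha]
    · intro hn; exact absurd (Finset.mem_univ _) hn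
  calc (∑ a : Fin (3 * D + 1), ∑ b : Fin (3 * D + 1), ∑ c : Fin (3 * D + 1),
        (∑ r : Fin (D + 1), ∑ j : Fin (D + 1),
          if a = A r j ∧ b = B r j ∧ c = C r j then ℓ r j else 0) *
          t ^ (a : ℕ) * v ^ (b : ℕ) * u ^ (c : ℕ))
      = ∑ a : Fin (3 * D + 1), ∑ b : Fin (3 * D + 1), ∑ c : Fin (3 * D + 1),
          ∑ r : Fin (D + 1), ∑ j : Fin (D + 1), X a b c r j := by
        simp only [Finset.sum_mul]
        rfl
    _ = ∑ a : Fin (3 * D + 1), ∑ b : Fin (3 * D + 1), ∑ r : Fin (D + 1),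
          ∑ c : Fin (3 * D + 1), ∑ j : Fin (D + 1), X a b c r j :=
        Finset.sum_congr rfl fun a _ => Finset.sum_congr rfl fun b _ => Finset.sum_comm
    _ = ∑ a : Fin (3 * D + 1), ∑ r : Fin (D + 1), ∑ b : Fin (3 * D + 1),
          ∑ c : Fin (3 * D + 1), ∑ j : Fin (D + 1), X a b c r j :=
        Finset.sum_congr rfl fun a _ => Finset.sum_comm
    _ = ∑ r : Fin (D + 1), ∑ a : Fin (3 * D + 1), ∑ b : Fin (3 * D + 1),
          ∑ c : Fin (3 * D + 1), ∑ j : Fin (D + 1), X a b c r j := Finset.sum_comm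
    _ = ∑ r : Fin (D + 1), ∑ a : Fin (3 * D + 1), ∑ b : Fin (3 * D + 1),
          ∑ j : Fin (D + 1), ∑ c : Fin (3 * D + 1), X a b c r j :=
        Finset.sum_congr rfl fun r _ => Finset.sum_congr rfl fun a _ =>
          Finset.sum_congr rfl fun b _ => Finset.sum_comm
    _ = ∑ r : Fin (D + 1), ∑ a : Fin (3 * D + 1), ∑ j : Fin (D + 1),
          ∑ b : Fin (3 * D + 1), ∑ c : Fin (3 * D + 1), X a b c r j :=
        Finset.sum_congr rfl fun r _ => Finset.sum_congr rfl fun a _ => Finset.sum_comm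
    _ = ∑ r : Fin (D + 1), ∑ j : Fin (D + 1), ∑ a : Fin (3 * D + 1),
          ∑ b : Fin (3 * D + 1), ∑ c : Fin (3 * D + 1), X a b c r j :=
        Finset.sum_congr rfl fun r _ => Finset.sum_comm
    _ = _ := Finset.sum_congr rfl fun r _ => Finset.sum_congr rfl fun j _ => hk r j

/-- **The piece is the bigraded sum of its rows.** -/
theorem G3p_eq_sum_Gam (β : Coef₃ D) (Qy Sy Qc Sc : ℝ) (i : Fin (D + 1)) (t v u : ℝ) :
    G3p β Qy Sy Qc Sc i t v u =
      ∑ a : Fin (3 * D + 1), ∑ b : Fin (3 * D + 1), Gam β Qy Sy Qc Sc i a b u * t ^ (a : ℕ) * v ^ (b : ℕ) := by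
  unfold Gam
  rw [sum₂_kron]
  unfold G3p
  refine Finset.sum_congr rfl fun r _ => Finset.sum_congr rfl fun j _ => ?_
  simp only [finA, finB]
  ring

/-- Under the row condition the second exponent is determined. -/
theorem j_eq_of_finB {i j : Fin (D + 1)} {b : Fin (3 * D + 1)} (h : b = finB i j) :
    (j : ℕ) = (b : ℕ) - i := by
  have := congrArg Fin.val h
  simp only [finB] at this
  omega

/-- **Closed form of the rows of the pieces.** -/
theorem Gam_eq (β : Coef₃ D) (Qy Sy Qc Sc : ℝ) (i : Fin (D + 1)) (a b : Fin (3 * D + 1)) (u : ℝ) :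
    Gam β Qy Sy Qc Sc i a b u =
      gam β i a b * (Qy + u * Sy) ^ (i : ℕ) * (Qc + u * Sc) ^ ((b : ℕ) - i) := by
  unfold Gam gam
  rw [Finset.sum_mul, Finset.sum_mul]
  refine Finset.sum_congr rfl fun r _ => ?_
  rw [Finset.sum_mul, Finset.sum_mul]
  refine Finset.sum_congr rfl fun j _ => ?_
  split_ifs with h
  · rw [j_eq_of_finB h.2]
  · simp

/-- Rows of pieces beyond the `v`-degree vanish. -/
theorem gam_eq_zero_of_lt (β : Coef₃ D) {i : Fin (D + 1)} {a b : Fin (3 * D + 1)}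
    (h : (b : ℕ) < i) : gam β i a b = 0 := by
  unfold gam
  refine Finset.sum_eq_zero fun r _ => Finset.sum_eq_zero fun j _ => ?_
  rw [if_neg]
  rintro ⟨-, hb⟩
  have := congrArg Fin.val hb
  simp only [finB] at this
  omega

/-- The coefficients of the row `(a, b)` indexed by `Fin (b + 1)`. -/
def gamFin (β : Coef₃ D) (a b : Fin (3 * D + 1)) (i : Fin ((b : ℕ) + 1)) : ℝ :=
  if h : (i : ℕ) < D + 1 then gam β ⟨i, h⟩ a b else 0

/-- **The row of the numerator in the shape of `SepHHK.indep_binary`.** -/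
theorem Hrow_eq (β : Coef₃ D) (Qy Sy Qc Sc : ℝ) (a b : Fin (3 * D + 1)) (u : ℝ) :
    Hrow β Qy Sy Qc Sc a b u = ∑ i : Fin ((b : ℕ) + 1),
      gamFin β a b i * (Qy + Sy * u) ^ (i : ℕ) * (Qc + Sc * u) ^ ((b : ℕ) - i) := by
  unfold Hrow
  simp_rw [Gam_eq]
  -- both sides as sums over `ℕ`
  set f : ℕ → ℝ := fun i => (if h : i < D + 1 then gam β ⟨i, h⟩ a b else 0) *
    (Qy + Sy * u) ^ i * (Qc + Sc * u) ^ ((b : ℕ) - i) with hf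
  have hL : (∑ i : Fin (D + 1), gam β i a b * (Qy + u * Sy) ^ (i : ℕ) * (Qc + u * Sc) ^ ((b : ℕ) - i)) =
      ∑ i ∈ Finset.range (D + 1), f i := by
    rw [← Fin.sum_univ_eq_sum_range]
    refine Finset.sum_congr rfl fun i _ => ?_
    simp only [hf, dif_pos i.2, mul_comm u Sy, mul_comm u Sc]
  have hR : (∑ i : Fin ((b : ℕ) + 1), gamFin β a b i * (Qy + Sy * u) ^ (i : ℕ) *
      (Qc + Sc * u) ^ ((b : ℕ) - i)) = ∑ i ∈ Finset.range ((b : ℕ) + 1), f i := by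
    rw [← Fin.sum_univ_eq_sum_range]
    exact Finset.sum_congr rfl fun i _ => by simp only [hf, gamFin]
  rw [hL, hR]
  -- both ranges can be cut to the smaller one since the extra terms vanish
  have hzero : ∀ i, D + 1 ≤ i ∨ (b : ℕ) + 1 ≤ i → f i = 0 := by
    intro i hi
    simp only [hf]
    rcases hi with hi | hi
    · rw [dif_neg (not_lt.2 hi), zero_mul, zero_mul]
    · by_cases hD : i < D + 1
      · rw [dif_pos hD, gam_eq_zero_of_lt β (show (b : ℕ) < (⟨i, hD⟩ : Fin (D + 1)) from
          Nat.lt_of_succ_le hi), zero_mul, zero_mul]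
      · rw [dif_neg hD, zero_mul, zero_mul]
  rcases le_total (D + 1) ((b : ℕ) + 1) with hle | hle
  · rw [← Finset.sum_subset (Finset.range_subset_range.2 hle) fun i _ hi =>
      hzero i (Or.inl (not_lt.1 (Finset.mem_range.not.1 hi)))]
  · rw [← Finset.sum_subset (Finset.range_subset_range.2 hle) fun i _ hi =>
      hzero i (Or.inr (not_lt.1 (Finset.mem_range.not.1 hi)))]

/-- **Bigrading exactness.** If the row `(a, b)` of the numerator vanishes on an interval
`(0, η)` and the frame is genuine (`Qy Sc − Qc Sy ≠ 0`), then the row `(a, b)` of every piece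
vanishes identically. -/
theorem Gam_zero_of_Hrow_zero (β : Coef₃ D) {Qy Sy Qc Sc : ℝ} (hdet : Qy * Sc - Qc * Sy ≠ 0)
    (a b : Fin (3 * D + 1)) {η : ℝ} (hη : 0 < η)
    (h : ∀ u ∈ Ioo 0 η, Hrow β Qy Sy Qc Sc a b u = 0) (i : Fin (D + 1)) (u : ℝ) :
    Gam β Qy Sy Qc Sc i a b u = 0 := by
  have hγ : gamFin β a b = 0 :=
    indep_binary (gamFin β a b) Qy Sy Qc Sc hdet hη fun u hu => by rw [← Hrow_eq]; exact h u hu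
  rw [Gam_eq]
  by_cases hib : (b : ℕ) < i
  · rw [gam_eq_zero_of_lt β hib]; simp
  · have hi : (i : ℕ) < (b : ℕ) + 1 := Nat.lt_succ_of_le (not_lt.1 hib)
    have h0 := congr_fun hγ ⟨i, hi⟩
    simp only [gamFin, Pi.zero_apply, dif_pos i.2] at h0
    rw [h0]; simp

/-- The row of the numerator as an honest polynomial in `u`. -/
def Rrow (β : Coef₃ D) (Qy Sy Qc Sc : ℝ) (a b : Fin (3 * D + 1)) : ℝ[X] :=
  ∑ i : Fin (D + 1), Polynomial.C (gam β i a b) * (Polynomial.C Qy + Polynomial.C Sy * Polynomial.X) ^ (i : ℕ) *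
    (Polynomial.C Qc + Polynomial.C Sc * Polynomial.X) ^ ((b : ℕ) - i)

/-- **Evaluation of the row polynomial.** -/
theorem eval_Rrow (β : Coef₃ D) (Qy Sy Qc Sc : ℝ) (a b : Fin (3 * D + 1)) (u : ℝ) :
    (Rrow β Qy Sy Qc Sc a b).eval u = Hrow β Qy Sy Qc Sc a b u := by
  unfold Rrow Hrow
  rw [Polynomial.eval_finsetSum]
  refine Finset.sum_congr rfl fun i _ => ?_
  rw [Gam_eq]
  simp only [Polynomial.eval_mul, Polynomial.eval_pow, Polynomial.eval_add, Polynomial.eval_C,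
    Polynomial.eval_X]
  ring

/-- The rows of the pieces are continuous in `u`. -/
theorem continuous_Gam (β : Coef₃ D) (Qy Sy Qc Sc : ℝ) (i : Fin (D + 1)) (a b : Fin (3 * D + 1)) :
    Continuous (Gam β Qy Sy Qc Sc i a b) := by
  have h : Gam β Qy Sy Qc Sc i a b = fun u =>
      gam β i a b * (Qy + u * Sy) ^ (i : ℕ) * (Qc + u * Sc) ^ ((b : ℕ) - i) :=
    funext fun u => Gam_eq β Qy Sy Qc Sc i a b u
  rw [h]
  fun_prop

/-! ### Monomial frames -/

/-- The coefficient tensor of the piece `i` in a monomial frame: the vertical frame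
(`Sy = 0`, `Qc = 0`: `L₁ = Qy`, `L₂ = Sc u`, exponent of `u` is `j`) for `vert = true`, the
slope-`0` frame (`Qy = 0`, `Sc = 0`: `L₁ = Sy u`, `L₂ = Qc`, exponent of `u` is `i`) otherwise. -/
def gmon (vert : Bool) (β : Coef₃ D) (Qy Sy Qc Sc : ℝ) (i : Fin (D + 1)) : Coef₃ (3 * D) :=
  fun a b c => ∑ r : Fin (D + 1), ∑ j : Fin (D + 1),
    if a = finA i r j ∧ b = finB i j ∧ c = (if vert then finC j else finC i) then
      β i r j * (if vert then Qy ^ (i : ℕ) * Sc ^ (j : ℕ) else Sy ^ (i : ℕ) * Qc ^ (j : ℕ)) else 0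

/-- **The tensor evaluates to the piece** (vertical frame). -/
theorem pev₃_gmon_vert (β : Coef₃ D) (Qy Sc : ℝ) (i : Fin (D + 1)) (t v u : ℝ) :
    pev₃ (gmon true β Qy 0 0 Sc i) t v u = G3p β Qy 0 0 Sc i t v u := by
  unfold gmon
  simp only [if_true]
  rw [pev₃_kron]
  unfold G3p
  refine Finset.sum_congr rfl fun r _ => Finset.sum_congr rfl fun j _ => ?_
  simp only [finA, finB, finC, mul_zero, add_zero, zero_add, mul_pow]
  ring

/-- **The tensor evaluates to the piece** (slope-`0` frame). -/
theorem pev₃_gmon_zero (β : Coef₃ D) (Sy Qc : ℝ) (i : Fin (D + 1)) (t v u : ℝ) :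
    pev₃ (gmon false β 0 Sy Qc 0 i) t v u = G3p β 0 Sy Qc 0 i t v u := by
  unfold gmon
  simp only [Bool.false_eq_true, if_false]
  rw [pev₃_kron]
  unfold G3p
  refine Finset.sum_congr rfl fun r _ => Finset.sum_congr rfl fun j _ => ?_
  simp only [finA, finB, finC, mul_zero, add_zero, zero_add, mul_pow]
  ring

/-- **Disjoint supports.** In a monomial frame the tensors of distinct pieces have disjoint
supports. -/
theorem gmon_disjoint (vert : Bool) (β : Coef₃ D) (Qy Sy Qc Sc : ℝ) (a b c : Fin (3 * D + 1))
    (i i' : Fin (D + 1)) (hi : gmon vert β Qy Sy Qc Sc i a b c ≠ 0)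
    (hi' : gmon vert β Qy Sy Qc Sc i' a b c ≠ 0) : i = i' := by
  -- a non-zero value forces the index relations
  have key : ∀ i₀ : Fin (D + 1), gmon vert β Qy Sy Qc Sc i₀ a b c ≠ 0 →
      ∃ r j : Fin (D + 1), b = finB i₀ j ∧ c = (if vert then finC j else finC i₀) := by
    intro i₀ h0
    by_contra hall
    push Not at hall
    apply h0
    unfold gmon
    refine Finset.sum_eq_zero fun r _ => Finset.sum_eq_zero fun j _ => ?_
    rw [if_neg]
    rintro ⟨-, hb, hc⟩
    exact hall r j hb hc
  obtain ⟨r, j, hb, hc⟩ := key i hi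
  obtain ⟨r', j', hb', hc'⟩ := key i' hi'
  have hbv := congrArg Fin.val hb
  have hbv' := congrArg Fin.val hb'
  simp only [finB] at hbv hbv'
  apply Fin.ext
  cases vert
  · simp only [Bool.false_eq_true, if_false] at hc hc'
    have hcv := congrArg Fin.val hc
    have hcv' := congrArg Fin.val hc'
    simp only [finC] at hcv hcv'
    omega
  · simp only [if_true] at hc hc'
    have hcv := congrArg Fin.val hc
    have hcv' := congrArg Fin.val hc'
    simp only [finC] at hcv hcv'
    omega

end SepHHK

/-- **Bigrading exactness of the adapted graded forms** (registered part of `stub_separateHigh`,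
base dimension `3` with fibres; literal form of `SepHHK.Gam_zero_of_Hrow_zero`): along a nested
sector at a direction of the pole plane with a genuine slope frame (`Qy Sc − Qc Sy ≠ 0`), if the
row `(a, b)` of the numerator vanishes on an interval `(0, η)`, then the row `(a, b)` of every
Taylor piece vanishes identically. -/
theorem separateThreeHHK_formsB (D : ℕ) (β : Fin (D + 1) → Fin (D + 1) → Fin (D + 1) → ℝ) (Qy Sy Qc Sc : ℝ) (hdet : Qy * Sc - Qc * Sy ≠ 0) (a b : Fin (3 * D + 1)) (η : ℝ) (hη : 0 < η) (h : ∀ u ∈ Set.Ioo 0 η, SepHHK.Hrow β Qy Sy Qc Sc a b u = 0) (i : Fin (D + 1)) (u : ℝ) : SepHHK.Gam β Qy Sy Qc Sc i a b u = 0 := by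
  exact SepHHK.Gam_zero_of_Hrow_zero β hdet a b hη h i u

end Summit.KontsevichZagierPeriods.ArrangementNormalForm.JanusBands
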